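import Literature.MathematicalPhysics.QuantumLattice.StaggeredMagnetisationSpinFlipBound
import HarnessLib

/-!
# Spin-flipped states: density matrices, mean entropy, periodic equilibria — staggered order implies
# coexistence of periodic equilibrium states

Sequel of `InfVolFermionStateSpinFlip` (the state `ω ∘ Γ_swap`) and `StaggeredMagnetisationSpinFlipBound` (the interaction `Ψ^swap`
and the spin-exchange invariance of the pressures):

* §1 `rdm_spinFlip`: the density matrices of `ω ∘ Γ_swap` are the spin-exchanged ones, `ρ^{ω∘Γ}_Λ = Γ_swap(ρ^ω_Λ)`; hence the box
  entropies, the box-entropy densities and **the mean entropy are spin-flip invariant** (`entropyDensitySup_spinFlip`);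
  `ω ∘ Γ_swap` is `q`-periodic when `ω` is.
* §2 energies: `ē_q(Ψ)(ω ∘ Γ) = ē_q(Ψ^swap)(ω)` (`cellMeanEnergy_spinFlip`); the staggered magnetisation is ODD,
  `m_s(ω ∘ Γ) = −m_s(ω)` (`staggeredMagnetisation_spinFlip`).
* §3 **periodic equilibrium states are carried to periodic equilibrium states**: `ω` equilibrium for `(β, Ψ)` ⇒ `ω ∘ Γ` equilibrium for
  `(β, Ψ^swap)` (`IsPerVarEquilibrium.spinFlip`); for the Hubbard model without staggered field (`hubbardStaggered d t U (a, 0)`, which is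
  its own spin flip) the set of `(2ℤ)^d`-periodic equilibrium states is spin-flip symmetric, and
  **STAGGERED ORDER IMPLIES COEXISTENCE**: an equilibrium state with `m_s(ω) ≠ 0` comes with a second, different equilibrium state `ω ∘ Γ`
  with the opposite staggered magnetisation (`exists_ne_isPerVarEquilibrium_of_staggeredMagnetisation_ne_zero`) — spontaneous breaking of
  the spin-exchange symmetry is non-uniqueness of the periodic equilibrium state.

Everything is PROVED; no definition, no named fact, no number. HONEST SCOPE: no statement on whether `m_s ≠ 0` occurs.

## Tree / Mathlib search

REUSED: `InfVolFermionState.spinFlip`, `spinFlip_expect`, `spinFlip_shift`, `spinFlip_spinFlip`, `spinFlip_expect_nAt`, `relabel_spinSwap_relabel_spinSwap`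
(`InfVolFermionStateSpinFlip`); `FermionInteraction.spinFlip(_apply)`, `perVarPressure_spinFlip`, `spinFlip_hubbardStaggered`
(`StaggeredMagnetisationSpinFlipBound`); `rdm(_apply)`, `trace_rdm_mul`, `rdm_isHermitian` (`InfVolFermionState`); `trace_relabel` (`FermionRelabelling`);
`vonNeumannEntropy_relabel` (`FermionPartialTrace`); `boxEntropyDensity`, `entropyDensitySup` (`TIVariationalPressure`); `IsPerVarEquilibrium`,
`siteEnergy_apply`, `cellMeanEnergy`, `staggeredMagnetisation`; Mathlib `Matrix.trace_single_mul`, `Matrix.trace_mul_comm`.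

## References

* R. B. Israel, *Convexity in the Theory of Lattice Gases* (1979), §IV.2 (symmetry breaking = several equilibrium states).
* O. Bratteli, D. W. Robinson, *OAQSM 2* (1997), §5.2.2 Thm. 5.2.5; Prop. 6.2.15 (entropy is invariant under automorphisms).
* H. Araki, H. Moriya, Rev. Math. Phys. 15 (2003) 93, §4.1, §12.
-/

noncomputable section

open scoped ComplexOrder BigOperators
open Finset Filter Topology

namespace Literature.MathematicalPhysics.QuantumLattice

open Matrix HubbardWave0 Literature.Probability.LatticeModels ThermodynamicLimit
open Literature.InformationTheory.Entropy (vonNeumannEntropy)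

variable {d : ℕ}

namespace InfVolFermionState

variable (ω : InfVolFermionState d)

/-! ### §1. Density matrices and mean entropy of the spin-flipped state -/

/-- **The density matrices of `ω ∘ Γ_swap` are the spin-exchanged density matrices**: `ρ^{ω∘Γ}_Λ = Γ_swap(ρ^ω_Λ)` (the spin exchange is an
involutive trace-preserving automorphism). [cite: BratteliRobinsonII1997, §5.2.2 Thm. 5.2.5] -/
theorem rdm_spinFlip (Λ : Finset (Site d)) :
    ω.spinFlip.rdm Λ = relabel (Orb.spinSwap : Orb (PolySite Λ) ≃ Orb (PolySite Λ)) (ω.rdm Λ) := by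
  ext s t
  have key : ∀ A : FermionOp Λ, ω.spinFlip.expect Λ A =
      (relabel (Orb.spinSwap : Orb (PolySite Λ) ≃ Orb (PolySite Λ)) (ω.rdm Λ) * A).trace := by
    intro A
    rw [spinFlip_expect, ← trace_rdm_mul]
    conv_lhs => rw [← relabel_spinSwap_relabel_spinSwap (ω.rdm Λ)]
    rw [← map_mul, trace_relabel]
  rw [rdm_apply, key, Matrix.trace_mul_comm, Matrix.trace_single_mul, one_smul]

/-- **Box entropies are spin-flip invariant**: `S(ρ^{ω∘Γ}_Λ) = S(ρ^ω_Λ)`. [cite: BratteliRobinsonII1997, Prop. 6.2.15] -/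
theorem vonNeumannEntropy_rdm_spinFlip (Λ : Finset (Site d)) :
    vonNeumannEntropy (ω.spinFlip.rdm Λ) = vonNeumannEntropy (ω.rdm Λ) := by
  rw [rdm_spinFlip, vonNeumannEntropy_relabel _ (ω.rdm_isHermitian Λ)]

/-- The box-entropy densities are spin-flip invariant. [cite: BratteliRobinsonII1997, Prop. 6.2.15] -/
theorem boxEntropyDensity_spinFlip : ω.spinFlip.boxEntropyDensity = ω.boxEntropyDensity := by
  funext ℓ
  rw [boxEntropyDensity_apply, boxEntropyDensity_apply, vonNeumannEntropy_rdm_spinFlip]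

/-- **The mean entropy is spin-flip invariant**: `s̄(ω ∘ Γ) = s̄(ω)`. [cite: BratteliRobinsonII1997, Prop. 6.2.15] -/
theorem entropyDensitySup_spinFlip : ω.spinFlip.entropyDensitySup = ω.entropyDensitySup := by
  rw [entropyDensitySup, entropyDensitySup, boxEntropyDensity_spinFlip]

/-- **The spin flip of a `q`-periodic state is `q`-periodic.** [cite: ArakiMoriya2003, §4.1 Def. 4.5] -/
theorem IsPeriodic.spinFlip {q : Fin d → ℕ} {ω : InfVolFermionState d} (hω : ω.IsPeriodic q) : ω.spinFlip.IsPeriodic q := fun i => by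
  rw [spinFlip_shift, hω i]

/-! ### §2. Energies and the staggered magnetisation of the spin-flipped state -/

/-- Site energies: `ε(Ψ)(ω ∘ Γ)(x) = ε(Ψ^swap)(ω)(x)`. [cite: BratteliKishimotoRobinson1978, §3 (mean energy functional)] -/
theorem siteEnergy_spinFlip (Ψ : FermionInteraction d) (R : ℝ) (x : Site d) :
    siteEnergy Ψ ω.spinFlip R x = siteEnergy Ψ.spinFlip ω R x := by
  simp only [siteEnergy_apply, spinFlip_expect, FermionInteraction.spinFlip_apply]

/-- **Cell energies: `ē_q(Ψ)(ω ∘ Γ) = ē_q(Ψ^swap)(ω)`.** [cite: BratteliKishimotoRobinson1978, §3 (mean energy functional)] -/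
theorem cellMeanEnergy_spinFlip (q : Fin d → ℕ) (Ψ : FermionInteraction d) (R : ℝ) :
    cellMeanEnergy q Ψ ω.spinFlip R = cellMeanEnergy q Ψ.spinFlip ω R := by
  unfold cellMeanEnergy
  simp only [siteEnergy_spinFlip]

/-- … equivalently `ē_q(Ψ^swap)(ω ∘ Γ) = ē_q(Ψ)(ω)` (the flip is an involution on the terms). [cite: BratteliKishimotoRobinson1978, §3] -/
theorem cellMeanEnergy_spinFlip_spinFlip (q : Fin d → ℕ) (Ψ : FermionInteraction d) (R : ℝ) :
    cellMeanEnergy q Ψ.spinFlip ω.spinFlip R = cellMeanEnergy q Ψ ω R := by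
  rw [cellMeanEnergy_spinFlip]
  unfold cellMeanEnergy
  simp only [siteEnergy_apply, FermionInteraction.spinFlip_apply, relabel_spinSwap_relabel_spinSwap]

/-- **The staggered magnetisation is odd under the spin flip**: `m_s(ω ∘ Γ) = −m_s(ω)`. [cite: KomaTasaki1994, §1] -/
theorem staggeredMagnetisation_spinFlip : ω.spinFlip.staggeredMagnetisation = -ω.staggeredMagnetisation := by
  unfold staggeredMagnetisation
  rw [← mul_neg, ← Finset.sum_neg_distrib]
  refine congrArg _ (Finset.sum_congr rfl fun c _ => ?_)
  rw [map_sub, map_sub, spinFlip_expect_nAt, spinFlip_expect_nAt, Equiv.swap_apply_left, Equiv.swap_apply_right, ← mul_neg,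
    ← Complex.neg_re, neg_sub]

/-! ### §3. Periodic equilibria under the spin flip; staggered order implies coexistence -/

variable {ω} {β R : ℝ} {q : Fin d → ℕ} {Ψ : FermionInteraction d}

/-- **The spin flip carries periodic equilibrium states of `Ψ` to periodic equilibrium states of `Ψ^swap`** (`d ≥ 1`; `Ψ` Hermitian, even,
`q`-periodic, finite range). [cite: Israel1979, Thm. I.2.4] [cite: BratteliRobinsonII1997, Prop. 6.2.15] -/
theorem IsPerVarEquilibrium.spinFlip (hd : 0 < d) (hH : Ψ.IsHermitian) (hE : Ψ.IsEven) (hΨ : Ψ.IsPeriodic q) (hR : Ψ.HasFiniteRange R)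
    (h : ω.IsPerVarEquilibrium β q Ψ R) : ω.spinFlip.IsPerVarEquilibrium β q Ψ.spinFlip R := by
  refine ⟨h.1.spinFlip, ?_⟩
  rw [entropyDensitySup_spinFlip, cellMeanEnergy_spinFlip_spinFlip, FermionInteraction.perVarPressure_spinFlip hd hH hE hΨ hR]
  exact h.2

/-- The Hubbard model without staggered field is its own spin flip: `(Ψ^{t,U}(a, 0))^swap = Ψ^{t,U}(a, 0)`.
[cite: BenfattoGiulianiMastropietro2006, §2.1 (symmetry (1), spin exchange)] -/
theorem _root_.Literature.MathematicalPhysics.QuantumLattice.spinFlip_hubbardStaggered_zero (t U a : ℝ) :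
    (hubbardStaggered d t U ![a, 0]).spinFlip = hubbardStaggered d t U ![a, 0] := by
  rw [spinFlip_hubbardStaggered]
  simp only [Matrix.cons_val_zero, Matrix.cons_val_one, neg_zero]

/-- **The set of `(2ℤ)^d`-periodic equilibrium states of the Hubbard model (no staggered field) is spin-flip symmetric** (`R ≥ 1`, `d ≥ 1`).
[cite: Israel1979, Thm. I.2.4] -/
theorem IsPerVarEquilibrium.spinFlip_hubbardStaggered_zero (hd : 0 < d) {t U a : ℝ} (hR : 1 ≤ R)
    (h : ω.IsPerVarEquilibrium β (evenPeriods d) (hubbardStaggered d t U ![a, 0]) R) :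
    ω.spinFlip.IsPerVarEquilibrium β (evenPeriods d) (hubbardStaggered d t U ![a, 0]) R := by
  obtain ⟨hH, hE, hP, hR1⟩ := hubbardStaggered_structure (d := d) t U ![a, 0]
  have hRR : (hubbardStaggered d t U ![a, 0]).HasFiniteRange R := fun X hX => hR1 X (lt_of_le_of_lt hR hX)
  have h' := h.spinFlip hd hH hE hP hRR
  rwa [Literature.MathematicalPhysics.QuantumLattice.spinFlip_hubbardStaggered_zero] at h'

/-- **STAGGERED ORDER IMPLIES COEXISTENCE**: if a `(2ℤ)^d`-periodic equilibrium state `ω` of the Hubbard model (no staggered field, `β`, `t`,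
`U`, `μ = −a` arbitrary, `R ≥ 1`, `d ≥ 1`) has `m_s(ω) ≠ 0`, then `ω ∘ Γ_swap ≠ ω` is a second periodic equilibrium state, with
`m_s(ω ∘ Γ) = −m_s(ω)`: spontaneous staggered (antiferromagnetic) order is non-uniqueness of the periodic equilibrium state.
[cite: Israel1979, Thm. I.2.4] -/
theorem exists_ne_isPerVarEquilibrium_of_staggeredMagnetisation_ne_zero (hd : 0 < d) {t U a : ℝ} (hR : 1 ≤ R)
    (h : ω.IsPerVarEquilibrium β (evenPeriods d) (hubbardStaggered d t U ![a, 0]) R) (hm : ω.staggeredMagnetisation ≠ 0) :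
    ∃ ω' : InfVolFermionState d, ω'.IsPerVarEquilibrium β (evenPeriods d) (hubbardStaggered d t U ![a, 0]) R ∧ ω' ≠ ω ∧
      ω'.staggeredMagnetisation = -ω.staggeredMagnetisation := by
  refine ⟨ω.spinFlip, h.spinFlip_hubbardStaggered_zero hd hR, fun heq => hm ?_, ω.staggeredMagnetisation_spinFlip⟩
  have h1 := ω.staggeredMagnetisation_spinFlip
  rw [heq] at h1
  linarith

end InfVolFermionState

end Literature.MathematicalPhysics.QuantumLattice

end
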